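import Summits.AtomisticToContinuum.HydrodynamicLimit.Theorems.EnskogAdjointDualityDualityReductionMoments
import HarnessLib

/-!
# EnskogAdjointDuality / DualityReduction — helper 4: moments of the local Maxwellian

Support lemmas for `Summit.AtomisticToContinuum.HydrodynamicLimit.Theses.EnskogAdjointDuality.DualityReduction`
(stmt-AtomisticToContinuum-11590). The Euler local Maxwellian `f_s = ρ_s M_{1, θ_s, u_s}` is
paired with the hydrodynamic test functions `a + b·v + e|v|²/2` (giving the Euler fields
`ρ (a + b·u + e(|u|²/2 + 3θ/2))`) and with kernels of quadratic-squared growth (the test-side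
Enskog operator); this file provides the identities and integrability/bounds, uniformly in
`‖u‖ ≤ U`, `0 < θ ≤ Θ`.

* `integral_localMaxwellian_mul_eq_integral_gaussMeasure` — `∫ M_{1,θ,u} g dv = ∫ g dN(u, θ id)`;
* `integral_localMaxwellian_mul_affine` — `∫ M (a + ⟪b, v⟫ + e |v|²/2) = a + ⟪b, u⟫ + e (|u|²/2 + 3θ/2)`;
* `integrable_one_add_norm_sq_pow_gaussMeasure`, `exists_integral_one_add_norm_sq_sq_gaussMeasure_le`
  — `(1 + |v|²)^k` is Gaussian-integrable, with a uniform bound for `k = 2`;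
* `integrable_localMaxwellian_mul_of_abs_le`, `abs_integral_localMaxwellian_mul_le` — pairing
  `M` with a measurable kernel `|g| ≤ K (1 + |v|²)²`.

References: H. Spohn, *Large Scale Dynamics of Interacting Particles* (1991), Part I §2.3
[Spohn1991].
-/

noncomputable section

open MeasureTheory ProbabilityTheory Set Filter Topology
open scoped ENNReal BigOperators InnerProductSpace

namespace Summit.AtomisticToContinuum.HydrodynamicLimit.Theorems

open Literature.Analysis.FluidPDE Literature.MathematicalPhysics.KineticTheory

/-- Pairing with the local Maxwellian density is integration against the Gaussian law:
`∫ M_{1,θ,u}(v) g(v) dv = ∫ g dN(u, θ id)` (`θ > 0`; both sides junk `0` together).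
[folklore] -/
theorem integral_localMaxwellian_mul_eq_integral_gaussMeasure {θ : ℝ} (hθ : 0 < θ) (u : V3)
    (g : V3 → ℝ) :
    ∫ v, localMaxwellian 1 θ u v * g v = ∫ v, g v ∂gaussMeasure u θ := by
  rw [← withDensity_localMaxwellian_eq_gaussMeasure hθ u,
    integral_withDensity_eq_integral_toReal_smul₀
      (continuous_localMaxwellian 1 θ u).measurable.ennreal_ofReal.aemeasurable
      (Eventually.of_forall fun _ => ENNReal.ofReal_lt_top)]
  refine integral_congr_ae (Eventually.of_forall fun v => ?_)
  simp only [smul_eq_mul]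
  rw [ENNReal.toReal_ofReal (localMaxwellian_nonneg zero_le_one hθ.le u v)]

/-- Integrability against the local Maxwellian density is Gaussian integrability. [folklore] -/
theorem integrable_localMaxwellian_mul_iff {θ : ℝ} (hθ : 0 < θ) (u : V3) (g : V3 → ℝ) :
    Integrable (fun v => localMaxwellian 1 θ u v * g v) ↔ Integrable g (gaussMeasure u θ) := by
  rw [← withDensity_localMaxwellian_eq_gaussMeasure hθ u,
    integrable_withDensity_iff_integrable_smul'
      (continuous_localMaxwellian 1 θ u).measurable.ennreal_ofReal
      (Eventually.of_forall fun _ => ENNReal.ofReal_lt_top)]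
  have : (fun v => (ENNReal.ofReal (localMaxwellian 1 θ u v)).toReal • g v) =
      fun v => localMaxwellian 1 θ u v * g v := by
    funext v
    rw [ENNReal.toReal_ofReal (localMaxwellian_nonneg zero_le_one hθ.le u v), smul_eq_mul]
  rw [this]

/-- The mean of the isotropic Gaussian: `∫ v dN(u, θ id) = u`. [folklore] -/
theorem integral_id_gaussMeasure (u : V3) {θ : ℝ} (hθ : 0 < θ) :
    ∫ v, v ∂gaussMeasure u θ = u := by
  have h2 : Integrable (fun w : V3 => Real.sqrt θ • w) (stdGaussian V3) :=
    (IsGaussian.integrable_id (μ := stdGaussian V3)).smul (Real.sqrt θ)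
  rw [integral_gaussMeasure u hθ, integral_add (integrable_const _) h2, integral_const,
    integral_smul, integral_id_stdGaussian, smul_zero, add_zero, probReal_univ, one_smul]

/-- **Hydrodynamic moments of the local Maxwellian**:
`∫ M_{1,θ,u}(v) (a + ⟪b, v⟫ + e |v|²/2) dv = a + ⟪b, u⟫ + e (|u|²/2 + 3θ/2)` (`θ > 0`).
[folklore] -/
theorem integral_localMaxwellian_mul_affine {θ : ℝ} (hθ : 0 < θ) (u : V3) (a e : ℝ) (b : V3) :
    ∫ v, localMaxwellian 1 θ u v * (a + ⟪b, v⟫_ℝ + e * ‖v‖ ^ 2 / 2) =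
      a + ⟪b, u⟫_ℝ + e * (‖u‖ ^ 2 / 2 + 3 * θ / 2) := by
  rw [integral_localMaxwellian_mul_eq_integral_gaussMeasure hθ]
  have hid : Integrable (fun v : V3 => v) (gaussMeasure u θ) := IsGaussian.integrable_id
  have hinner : Integrable (fun v : V3 => ⟪b, v⟫_ℝ) (gaussMeasure u θ) := hid.const_inner b
  have hsq : Integrable (fun v : V3 => ‖v‖ ^ 2) (gaussMeasure u θ) :=
    (IsGaussian.memLp_id _ 2 (by simp)).integrable_norm_pow (by norm_num)
  have hen : Integrable (fun v : V3 => e * ‖v‖ ^ 2 / 2) (gaussMeasure u θ) := by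
    have : (fun v : V3 => e * ‖v‖ ^ 2 / 2) = fun v => (e / 2) * ‖v‖ ^ 2 := by
      funext v; ring
    rw [this]
    exact hsq.const_mul _
  have henergy := integral_energy_gaussMeasure u hθ
  have hsq_val : ∫ v, ‖v‖ ^ 2 ∂gaussMeasure u θ = ‖u‖ ^ 2 + 3 * θ := by
    have h1 : ∫ v, (‖v‖ ^ 2 / 2 - ‖u‖ ^ 2 / 2 - (Fintype.card (Fin 3)) * θ / 2) ∂gaussMeasure u θ =
        (∫ v, ‖v‖ ^ 2 ∂gaussMeasure u θ) / 2 - ‖u‖ ^ 2 / 2 - 3 * θ / 2 := by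
      rw [integral_sub, integral_sub, integral_const, integral_const]
      · simp only [smul_eq_mul, probReal_univ, one_mul, Fintype.card_fin, Nat.cast_ofNat]
        rw [show (fun v : V3 => ‖v‖ ^ 2 / 2) = fun v => (1 / 2) * ‖v‖ ^ 2 from by
          funext v; ring, integral_const_mul]
        ring
      · exact (hsq.div_const 2)
      · exact integrable_const _
      · exact (hsq.div_const 2).sub (integrable_const _)
      · exact integrable_const _
    rw [h1] at henergy
    linarith
  rw [integral_add, integral_add, integral_const, integral_inner hid, integral_id_gaussMeasure u hθ]
  · simp only [smul_eq_mul, probReal_univ, one_mul]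
    rw [show (fun v : V3 => e * ‖v‖ ^ 2 / 2) = fun v => (e / 2) * ‖v‖ ^ 2 from by funext v; ring,
      integral_const_mul, hsq_val]
    ring
  · exact integrable_const _
  · exact hinner
  · exact (integrable_const _).add hinner
  · exact hen

/-- `(1 + |v|²)^k` is integrable under the isotropic Gaussian (Fernique). [folklore] -/
theorem integrable_one_add_norm_sq_pow_gaussMeasure (u : V3) (θ : ℝ) (k : ℕ) :
    Integrable (fun v : V3 => (1 + ‖v‖ ^ 2) ^ k) (gaussMeasure u θ) := by
  have hb : ∀ v : V3, (1 + ‖v‖ ^ 2) ^ k ≤ 2 ^ (k - 1) * (1 + ‖v‖ ^ (2 * k)) := by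
    intro v
    have h := add_pow_le zero_le_one (sq_nonneg ‖v‖) k
    rw [one_pow, ← pow_mul] at h
    exact h
  have hint : Integrable (fun v : V3 => 2 ^ (k - 1) * (1 + ‖v‖ ^ (2 * k))) (gaussMeasure u θ) := by
    refine ((integrable_const _).add ?_).const_mul _
    rcases Nat.eq_zero_or_pos k with hk | hk
    · subst hk
      simp
    · exact (IsGaussian.memLp_id _ (2 * k : ℕ) (ENNReal.natCast_ne_top _)).integrable_norm_pow
        (by exact_mod_cast (by omega : 2 * k ≠ 0))
  refine hint.mono' (by fun_prop) (Eventually.of_forall fun v => ?_)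
  rw [Real.norm_eq_abs, abs_of_nonneg (by positivity)]
  exact hb v

/-- Uniform bound `∫ (1 + |v|²)² dN(u, θ id) ≤ C(U, Θ)` for `‖u‖ ≤ U`, `0 < θ ≤ Θ`. [folklore] -/
theorem exists_integral_one_add_norm_sq_sq_gaussMeasure_le (U Θ : ℝ) :
    ∃ C : ℝ, 0 ≤ C ∧ ∀ (u : V3) (θ : ℝ), ‖u‖ ≤ U → 0 < θ → θ ≤ Θ →
      ∫ v, (1 + ‖v‖ ^ 2) ^ 2 ∂gaussMeasure u θ ≤ C := by
  obtain ⟨C₄, hC₄0, hC₄⟩ := exists_integral_norm_pow_gaussMeasure_le U Θ (n := 4) (by norm_num)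
  refine ⟨2 * (1 + C₄), by positivity, fun u θ hu hθ hθΘ => ?_⟩
  have h4 : Integrable (fun v : V3 => ‖v‖ ^ 4) (gaussMeasure u θ) :=
    (IsGaussian.memLp_id _ 4 (by simp)).integrable_norm_pow (by norm_num)
  have hpt : ∀ v : V3, (1 + ‖v‖ ^ 2) ^ 2 ≤ 2 * (1 + ‖v‖ ^ 4) := fun v => by
    nlinarith [sq_nonneg (‖v‖ ^ 2 - 1)]
  calc ∫ v, (1 + ‖v‖ ^ 2) ^ 2 ∂gaussMeasure u θ
      ≤ ∫ v, 2 * (1 + ‖v‖ ^ 4) ∂gaussMeasure u θ :=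
        integral_mono_of_nonneg (Eventually.of_forall fun v => by positivity)
          (((integrable_const _).add h4).const_mul _) (Eventually.of_forall hpt)
    _ = 2 * (1 + ∫ v, ‖v‖ ^ 4 ∂gaussMeasure u θ) := by
        rw [integral_const_mul, integral_add (integrable_const _) h4, integral_const, smul_eq_mul,
          probReal_univ, one_mul]
    _ ≤ 2 * (1 + C₄) := by gcongr; exact hC₄ u θ hu hθ hθΘ

/-- Pairing the local Maxwellian with a measurable kernel of growth `|g| ≤ K (1 + |v|²)²` is
absolutely convergent. [folklore] -/
theorem integrable_localMaxwellian_mul_of_abs_le {θ : ℝ} (hθ : 0 < θ) (u : V3) {g : V3 → ℝ}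
    (hg : AEStronglyMeasurable g volume) {K : ℝ} (hK : ∀ v, |g v| ≤ K * (1 + ‖v‖ ^ 2) ^ 2) :
    Integrable (fun v => localMaxwellian 1 θ u v * g v) := by
  have hdom : Integrable (fun v => localMaxwellian 1 θ u v * (K * (1 + ‖v‖ ^ 2) ^ 2)) := by
    rw [integrable_localMaxwellian_mul_iff hθ]
    exact (integrable_one_add_norm_sq_pow_gaussMeasure u θ 2).const_mul K
  refine hdom.mono' ((continuous_localMaxwellian 1 θ u).aestronglyMeasurable.mul hg)
    (Eventually.of_forall fun v => ?_)
  rw [Real.norm_eq_abs, abs_mul, abs_of_nonneg (localMaxwellian_nonneg zero_le_one hθ.le u v)]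
  exact mul_le_mul_of_nonneg_left (hK v) (localMaxwellian_nonneg zero_le_one hθ.le u v)

/-- Bound for the pairing of the local Maxwellian with a kernel `|g| ≤ K (1 + |v|²)²`:
`|∫ M g| ≤ K ∫ (1 + |v|²)² dN(u, θ id)`. [folklore] -/
theorem abs_integral_localMaxwellian_mul_le {θ : ℝ} (hθ : 0 < θ) (u : V3) {g : V3 → ℝ}
    {K : ℝ} (hK : ∀ v, |g v| ≤ K * (1 + ‖v‖ ^ 2) ^ 2) :
    |∫ v, localMaxwellian 1 θ u v * g v| ≤ K * ∫ v, (1 + ‖v‖ ^ 2) ^ 2 ∂gaussMeasure u θ := by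
  rw [integral_localMaxwellian_mul_eq_integral_gaussMeasure hθ, ← integral_const_mul]
  have h := norm_integral_le_of_norm_le
    ((integrable_one_add_norm_sq_pow_gaussMeasure u θ 2).const_mul K)
    (Eventually.of_forall fun v => by rw [Real.norm_eq_abs]; exact hK v)
  rwa [Real.norm_eq_abs] at h

end Summit.AtomisticToContinuum.HydrodynamicLimit.Theorems

end
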